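import Mathlib
import Summits.CriticalPhenomena.PercolationContinuityZ3.Theorems.PercNearOneGluingNoHeavyLowerTailEqualRatioHurwitzTN
import HarnessLib

/-!
# COROLLARY E′: peeling one further sub-neutral copy off an equal-ratio block (𝒪₀ for T+1 copies)

Support file for the Sahi / Conjecture-P programme of route `PercNearOneGluingNoHeavy`
(`--supports stmt-CriticalPhenomena-4575`, prover prim-l12-p5 gen 48; proof note
`prim-l12-p5/PROOF-DIFFERENCE-HURWITZ-g48.md` §0(iv), and g46's REDUCTION THEOREM `PROOF-HURWITZ-TRANSFER-g46.md` §1).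
No definitions, no named facts, no sorries.

The COPY-PEELING IDENTITY (g46 (1.2)): for copies `S ∪ {φ}`, `φ = b + gX`, `h = 1 - g`, at level `p > 0`,
`p · W_{S∪φ}^{(p)}(n,·) = (p + g n) W′(n,·) + b n W′(n-1,·) + h n C′(n-1,·)` with `W′ = W_S^{(p+1)}` and
`C′(n,l) = W′(n+1,l) - W′(n,l-1)` its commutator rows; the left factor `[B | hD]` is a staircase kernel on the
doubled index.  `DiffHurwitz.peel_tn`: if `interleave(W′, C′)` is TN and `p, g, b, h ≥ 0`, the peeled kernel is
TN (generic).  `DiffHurwitz.equalRatio_peel_tn` (**COROLLARY E′**): with `W′` the band matrix of `T` equal-ratio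
sub-neutral copies at level `p+1` (`DiffHurwitz.equalRatio_hurwitz_tn`), the kernel
`(p + g n) W′(n,l) + b n W′(n-1,l) + h n (W′(n,l) - W′(n-1,l-1))` — i.e. `p·W_{T+1}^{(p)}`, the λ-free band matrix
`𝒪₀` of the `T+1` copies up to positive diagonal factors — is totally nonnegative.
-/

namespace Summit.CriticalPhenomena.PercolationContinuityZ3.Theorems

namespace DiffHurwitz

open Finset Matrix

/-- Staircase kernels on the doubled index: rows `n ↦ (c n, b n, a n)` at columns `2n-2, 2n-1, 2n` with
nonnegative entries form a totally nonnegative kernel (each square submatrix on increasing rows/columns has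
at most the diagonal transversal). -/
theorem stairs3_minor_nonneg (a b c : ℕ → ℝ) (ha : ∀ n, 0 ≤ a n) (hb : ∀ n, 0 ≤ b n) (hc : ∀ n, 0 ≤ c n) :
    ∀ {k : ℕ} (r s : Fin k → ℕ), StrictMono r → StrictMono s →
      0 ≤ (Matrix.of fun i j => (if s j = 2 * r i then a (r i) else if s j + 1 = 2 * r i then b (r i)
        else if s j + 2 = 2 * r i then c (r i) else 0 : ℝ)).det := by
  intro k
  induction k with
  | zero => intro r s _ _; simp
  | succ k ih =>
    intro r s hr hs
    set M : Matrix (Fin k.succ) (Fin k.succ) ℝ := Matrix.of fun i j =>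
      (if s j = 2 * r i then a (r i) else if s j + 1 = 2 * r i then b (r i)
        else if s j + 2 = 2 * r i then c (r i) else 0 : ℝ) with hM
    have hsub : M.submatrix Fin.succ Fin.succ = Matrix.of fun i j =>
        (if s (Fin.succ j) = 2 * r (Fin.succ i) then a (r (Fin.succ i))
          else if s (Fin.succ j) + 1 = 2 * r (Fin.succ i) then b (r (Fin.succ i))
          else if s (Fin.succ j) + 2 = 2 * r (Fin.succ i) then c (r (Fin.succ i)) else 0 : ℝ) := by
      ext i j; rfl
    have hr' : StrictMono (fun i : Fin k => r (Fin.succ i)) :=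
      fun x y hxy => hr (Fin.succ_lt_succ_iff.mpr hxy)
    have hs' : StrictMono (fun j : Fin k => s (Fin.succ j)) :=
      fun x y hxy => hs (Fin.succ_lt_succ_iff.mpr hxy)
    have hIH : 0 ≤ (M.submatrix Fin.succ Fin.succ).det := by rw [hsub]; exact ih _ _ hr' hs'
    have hent : ∀ i j, 0 ≤ M i j := by
      intro i j; rw [hM, Matrix.of_apply]; split_ifs
      exacts [ha _, hb _, hc _, le_rfl]
    rcases Nat.lt_or_ge (s 0) (2 * r 0) with hcase | hcase
    · -- column 0 vanishes below row 0 (later rows start at 2 r i - 2 ≥ 2 r 0 > s 0)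
      have hcol : ∀ i : Fin k.succ, i ≠ 0 → M i 0 = 0 := by
        intro i hi
        rw [hM, Matrix.of_apply]
        have h1 : r 0 < r i := hr (Fin.pos_iff_ne_zero.mpr hi)
        rw [if_neg (by omega), if_neg (by omega), if_neg (by omega)]
      rw [Matrix.det_succ_column_zero, Finset.sum_eq_single (0 : Fin k.succ)]
      · simp only [Fin.val_zero, pow_zero, one_mul, Fin.succAbove_zero]
        exact mul_nonneg (hent 0 0) hIH
      · intro i _ hi; rw [hcol i hi]; simp
      · intro h; exact absurd (Finset.mem_univ _) h
    · -- row 0 vanishes right of column 0 (s j > s 0 ≥ 2 r 0)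
      have hrow : ∀ j : Fin k.succ, j ≠ 0 → M 0 j = 0 := by
        intro j hj
        rw [hM, Matrix.of_apply]
        have h1 : s 0 < s j := hs (Fin.pos_iff_ne_zero.mpr hj)
        rw [if_neg (by omega), if_neg (by omega), if_neg (by omega)]
      rw [Matrix.det_succ_row_zero, Finset.sum_eq_single (0 : Fin k.succ)]
      · simp only [Fin.val_zero, pow_zero, one_mul, Fin.succAbove_zero]
        exact mul_nonneg (hent 0 0) hIH
      · intro j _ hj; rw [hrow j hj]; simp
      · intro h; exact absurd (Finset.mem_univ _) h

/-- **Generic peeling step.**  If `interleave(X, Y)` (rows `2n ↦ X n`, `2n+1 ↦ Y n`) is TN and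
`α, β, γ ≥ 0` with `β 0 = γ 0 = 0`, then `(n,l) ↦ α n X n l + β n Y (n-1) l + γ n X (n-1) l` is TN. -/
theorem peel_tn (X Y : ℕ → ℕ → ℝ) (α β γ : ℕ → ℝ) (hα : ∀ n, 0 ≤ α n) (hβ : ∀ n, 0 ≤ β n)
    (hγ : ∀ n, 0 ≤ γ n) (hβ0 : β 0 = 0) (hγ0 : γ 0 = 0)
    (hR : ∀ (k : ℕ) (r c : Fin k → ℕ), StrictMono r → StrictMono c →
      0 ≤ (Matrix.of fun i j => if r i % 2 = 0 then X (r i / 2) (c j) else Y (r i / 2) (c j)).det)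
    {k : ℕ} (r c : Fin k → ℕ) (hr : StrictMono r) (hc : StrictMono c) :
    0 ≤ (Matrix.of fun i j => α (r i) * X (r i) (c j) + β (r i) * Y (r i - 1) (c j)
      + γ (r i) * X (r i - 1) (c j)).det := by
  cases k with
  | zero => simp
  | succ k =>
    set Rk : ℕ → ℕ → ℝ := fun t l => if t % 2 = 0 then X (t / 2) l else Y (t / 2) l with hRk
    set L : ℕ → ℕ → ℝ := fun n t => if t = 2 * n then α n else if t + 1 = 2 * n then β n
      else if t + 2 = 2 * n then γ n else 0 with hL
    -- the kernel is the banded product Σ_{t ≤ 2n} L n t · Rk t l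
    have hsum : ∀ n l, ∑ t ∈ range (2 * n + 1), L n t * Rk t l
        = α n * X n l + β n * Y (n - 1) l + γ n * X (n - 1) l := by
      intro n l
      rcases Nat.eq_zero_or_pos n with hn | hn
      · subst hn
        rw [hβ0, hγ0]; simp [hL, hRk]
      · obtain ⟨m, rfl⟩ : ∃ m, n = m + 1 := ⟨n - 1, by omega⟩
        rw [show 2 * (m + 1) + 1 = 2 * m + 1 + 1 + 1 by ring, sum_range_succ, sum_range_succ, sum_range_succ]
        have hrest : ∑ t ∈ range (2 * m), L (m + 1) t * Rk t l = 0 := by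
          refine sum_eq_zero fun t ht => ?_
          rw [mem_range] at ht
          have : L (m + 1) t = 0 := by
            simp only [hL]; rw [if_neg (by omega), if_neg (by omega), if_neg (by omega)]
          rw [this, zero_mul]
        have hL0 : L (m + 1) (2 * m) = γ (m + 1) := by
          simp only [hL]; rw [if_neg (by omega), if_neg (by omega), if_pos (by omega)]
        have hL1 : L (m + 1) (2 * m + 1) = β (m + 1) := by
          simp only [hL]; rw [if_neg (by omega), if_pos (by omega)]
        have hL2 : L (m + 1) (2 * m + 1 + 1) = α (m + 1) := by
          simp only [hL]; rw [if_pos (by omega)]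
        have hR0 : Rk (2 * m) l = X m l := by
          simp only [hRk]; rw [if_pos (by omega), show 2 * m / 2 = m by omega]
        have hR1 : Rk (2 * m + 1) l = Y m l := by
          simp only [hRk]; rw [if_neg (by omega), show (2 * m + 1) / 2 = m by omega]
        have hR2 : Rk (2 * m + 1 + 1) l = X (m + 1) l := by
          simp only [hRk]; rw [if_pos (by omega), show (2 * m + 1 + 1) / 2 = m + 1 by omega]
        rw [hrest, zero_add, hL0, hL1, hL2, hR0, hR1, hR2, show m + 1 - 1 = m by omega]
        ring
    have hM : (Matrix.of fun i j => α (r i) * X (r i) (c j) + β (r i) * Y (r i - 1) (c j)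
        + γ (r i) * X (r i - 1) (c j)) = Matrix.of fun i j => ∑ t ∈ range (2 * r i + 1), L (r i) t * Rk t (c j) := by
      ext i j; rw [Matrix.of_apply, Matrix.of_apply, hsum]
    rw [hM]
    -- Cauchy–Binet on the common range
    set R : ℕ := 2 * r (Fin.last k) + 1 with hRdef
    have hrR : ∀ i, 2 * r i < R := fun i =>
      Nat.lt_succ_of_le (Nat.mul_le_mul_left 2 (hr.monotone (Fin.le_last i)))
    have hband : ∀ n t, 2 * n < t → L n t = 0 := by
      intro n t hnt; simp only [hL]; rw [if_neg (by omega), if_neg (by omega), if_neg (by omega)]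
    let A' : Matrix (Fin (k + 1)) (Fin R) ℝ := Matrix.of fun i t => L (r i) t
    let B' : Matrix (Fin R) (Fin (k + 1)) ℝ := Matrix.of fun t j => Rk t (c j)
    have hAB : (Matrix.of fun i j => ∑ t ∈ range (2 * r i + 1), L (r i) t * Rk t (c j)) = A' * B' := by
      ext i j
      rw [Matrix.mul_apply, Matrix.of_apply]
      have h1 : ∑ t ∈ range (2 * r i + 1), L (r i) t * Rk t (c j) = ∑ t ∈ range R, L (r i) t * Rk t (c j) := by
        refine Finset.sum_subset (fun t ht => ?_) (fun t _ ht => ?_)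
        · rw [mem_range] at ht ⊢; exact lt_of_lt_of_le ht (hrR i)
        · rw [mem_range, not_lt] at ht
          rw [hband (r i) t (by omega), zero_mul]
      rw [h1, ← Fin.sum_univ_eq_sum_range (fun t => L (r i) t * Rk t (c j)) R]
      rfl
    rw [hAB, Literature.Analysis.TotalPositivity.det_mul_eq_sum_strictMono]
    refine Finset.sum_nonneg fun t ht => ?_
    rw [mem_filter] at ht
    have htm : StrictMono (fun j => ((t j : Fin R) : ℕ)) := fun a b hab => Fin.lt_def.1 (ht.2 hab)
    refine mul_nonneg ?_ ?_
    · have : A'.submatrix id t = Matrix.of fun i j => L (r i) ((t j : Fin R) : ℕ) := by ext i j; rfl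
      rw [this]
      have key := stairs3_minor_nonneg α β γ hα hβ hγ r (fun j => ((t j : Fin R) : ℕ)) hr htm
      simp only [hL]
      exact key
    · have : B'.submatrix t id = Matrix.of fun i j => Rk ((t i : Fin R) : ℕ) (c j) := by ext i j; rfl
      rw [this]
      exact hR (k + 1) (fun i => ((t i : Fin R) : ℕ)) c htm hc

/-- **COROLLARY E′ (peeled equal-ratio block).**  Let `W` be the λ-free band matrix of `T` equal-ratio sub-neutral
copies at level `p + 1` (as in `equalRatio_hurwitz_tn`, `κ ≥ 0`, `0 < g_s < 1`, `p > 0`) and let `φ = b + gX` be one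
more copy with `b, g ≥ 0`, `h = 1 - g ≥ 0`.  Then the kernel
`(n,l) ↦ (p + g n) W(n,l) + h n (W(n,l) - [1 ≤ l] W(n-1,l-1)) + b n W(n-1,l)` — by the copy-peeling identity this is
`p · W_{T+1}^{(p)}`, the band matrix `𝒪₀` of the `T+1` copies up to positive diagonal factors — is TN. -/
theorem equalRatio_peel_tn (κ p : ℝ) (hκ : 0 ≤ κ) (hp : 0 < p) (T : ℕ) (g : ℕ → ℝ)
    (hg : ∀ t, 0 < g t ∧ g t < 1) (e : ℕ → ℕ → ℝ) (he00 : e 0 0 = 1) (he0s : ∀ j, e 0 (j + 1) = 0)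
    (hes0 : ∀ t, e (t + 1) 0 = e t 0) (hess : ∀ t j, e (t + 1) (j + 1) = e t (j + 1) + g t * e t j)
    (W : ℕ → ℕ → ℝ)
    (hW : ∀ n l, W n l = if l ≤ n then κ ^ (n - l) * ∑ j ∈ range (T + 1),
      e T j * (n.descFactorial j : ℝ) / (∏ i ∈ range j, (p + 1 + (i : ℝ))) * (j.choose (n - l) : ℝ) else 0)
    (b g' : ℝ) (hb : 0 ≤ b) (hg' : 0 ≤ g') (hh : g' ≤ 1)
    {m : ℕ} (r c : Fin m → ℕ) (hr : StrictMono r) (hc : StrictMono c) :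
    0 ≤ (Matrix.of fun i j => (p + g' * r i) * W (r i) (c j)
      + (1 - g') * r i * (W (r i) (c j) - if 1 ≤ c j then W (r i - 1) (c j - 1) else 0)
      + b * r i * W (r i - 1) (c j)).det := by
  have hR := fun (k : ℕ) (r' c' : Fin k → ℕ) (hr' : StrictMono r') (hc' : StrictMono c') =>
    equalRatio_hurwitz_tn κ (p + 1) hκ (by linarith) T g hg e he00 he0s hes0 hess W hW r' c' hr' hc'
  have key := peel_tn W (fun n l => W (n + 1) l - if 1 ≤ l then W n (l - 1) else 0)
    (fun n => p + g' * n) (fun n => (1 - g') * n) (fun n => b * n)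
    (fun n => by positivity) (fun n => mul_nonneg (by linarith) (Nat.cast_nonneg n))
    (fun n => mul_nonneg hb (Nat.cast_nonneg n)) (by simp) (by simp) hR r c hr hc
  have hM : (Matrix.of fun i j => (p + g' * r i) * W (r i) (c j)
      + (1 - g') * r i * (W (r i) (c j) - if 1 ≤ c j then W (r i - 1) (c j - 1) else 0)
      + b * r i * W (r i - 1) (c j))
      = Matrix.of fun i j => (p + g' * (r i : ℕ)) * W (r i) (c j)
        + (1 - g') * (r i : ℕ) * (W (r i - 1 + 1) (c j) - if 1 ≤ c j then W (r i - 1) (c j - 1) else 0)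
        + b * (r i : ℕ) * W (r i - 1) (c j) := by
    ext i j
    simp only [Matrix.of_apply]
    rcases Nat.eq_zero_or_pos (r i) with h0 | h0
    · rw [h0]; simp
    · rw [Nat.sub_add_cancel h0]
  rw [hM]; exact key

end DiffHurwitz

end Summit.CriticalPhenomena.PercolationContinuityZ3.Theorems
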